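import Summits.MatrixMultiplication.MatrixMultiplication.Theorems.ObstructionDescentFormatTwoLevels

set_option linter.dupNamespace false

/-!
# Obstruction descent, part Q — the passing levels of format 2: `passLevels m 2 = {k | k even}`

`route-MatrixMultiplication-ObstructionDescent`, aside `InvariantSaturation` (stmt 32282); decomp-mm lens-3, NODE-g15.

Parts N–O decided the EMPTY levels of block format `2` (`k ∈ emptyLevels m 2 ↔ k` odd).  This file decides the PASSING
levels — the levels carrying a vector that does not vanish on the unit-tensor orbit `GL_m³·⟨m⟩` — for the same column:
`k ∈ passLevels m 2 ↔ k` even (`mem_passLevels_two_iff`), for every `m ≥ 2`.  So the first column of the invariant tower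
is completely decided and periodic from the start: `E_m(2) = 2ℕ + 1`, `P_m(2) = 2ℕ`, no level is neither.

Odd levels are empty, hence do not pass.  Even levels pass because the lift of CAYLEY'S HYPERDETERMINANT `Δ` to the corner
`((0^{m−2}, 2, 2))³` is a level-`2` vector with `Δ(corner of ⟨m⟩) = Δ(⟨2⟩) = 1` (`exists_level_two_vector_unit`,
`cornerOf_unitTensor`, `two_mem_passLevels_two`), and passing levels form a semigroup (`mul_mem_passLevels`).

[cite: BurgisserIkenmeyer2011, §3.1–3.2, Lemma 3.2], [cite: BurgisserIkenmeyer2017, §5 (5.2), Thm 5.3],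
[cite: LandsbergGCT2017, §8.3.4].
-/

noncomputable section

open scoped BigOperators
open Finset

namespace Summit.MatrixMultiplication.MatrixMultiplication.Theorems.ObstructionCalculus

open Literature.Computability.AlgebraicComplexity (actTensor actTensor_apply actTensor_one unitTensor unitTensor_apply)

section FormatTwoPassLevels

/-- **Cayley's hyperdeterminant does not vanish at the unit tensor:** there is a weight vector `Δ` of type
`((2,2),(2,2),(2,2))`, degree `4`, with `Δ(⟨2⟩) = 1`. [this node] -/
theorem exists_level_two_vector_unit :
    ∃ Δ : MvPolynomial (Idx 2) ℂ, evalT (unitTensor ℂ 2) Δ = 1 ∧ Δ ∈ hwvSpace (rectType 2 2 2) (2 * 2) := by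
  classical
  let X : Fin 2 → Fin 2 → Fin 2 → MvPolynomial (Idx 2) ℂ := fun a b c => MvPolynomial.X (a, b, c)
  refine ⟨X 0 0 0 ^ 2 * X 1 1 1 ^ 2 + X 0 0 1 ^ 2 * X 1 1 0 ^ 2 + X 0 1 0 ^ 2 * X 1 0 1 ^ 2 + X 0 1 1 ^ 2 * X 1 0 0 ^ 2
    - 2 * (X 0 0 0 * X 0 0 1 * X 1 1 0 * X 1 1 1 + X 0 0 0 * X 0 1 0 * X 1 0 1 * X 1 1 1
      + X 0 0 0 * X 0 1 1 * X 1 0 0 * X 1 1 1 + X 0 0 1 * X 0 1 0 * X 1 0 1 * X 1 1 0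
      + X 0 0 1 * X 0 1 1 * X 1 1 0 * X 1 0 0 + X 0 1 0 * X 0 1 1 * X 1 0 1 * X 1 0 0)
    + 4 * (X 0 0 0 * X 0 1 1 * X 1 0 1 * X 1 1 0 + X 0 0 1 * X 0 1 0 * X 1 0 0 * X 1 1 1), ?_, ?_, ?_⟩
  · simp [X, evalT, map_add, map_sub, map_mul, map_pow, MvPolynomial.aeval_X]
  · refine isHomogeneous_of_eval_smul_ne_zero _ (2 * 2) fun s _ y => ?_
    simp only [X, map_add, map_sub, map_mul, map_pow, map_ofNat, MvPolynomial.eval_X, Pi.smul_apply, smul_eq_mul]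
    ring
  · intro A B C hA hB hC t
    have hA0 : A 1 0 = 0 := hA.1 1 0 (by decide)
    have hB0 : B 1 0 = 0 := hB.1 1 0 (by decide)
    have hC0 : C 1 0 = 0 := hC.1 1 0 (by decide)
    simp only [X, evalT, map_add, map_sub, map_mul, map_pow, map_ofNat, MvPolynomial.aeval_X, weightChar,
      Fin.prod_univ_two, rectType_self_apply, actTensor_apply, Fin.sum_univ_two, hA0, hB0, hC0]
    ring

/-- The corner of a unit tensor is the unit tensor. [bookkeeping] -/
theorem cornerOf_unitTensor (d m : ℕ) : cornerOf d (unitTensor ℂ (d + m)) = unitTensor ℂ m := by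
  funext a b c
  simp only [cornerOf, unitTensor_apply, ← Fin.val_inj, Fin.val_natAdd, add_right_inj]

/-- **Level 2 passes at block format 2:** for `m ≥ 2` the corner lift of `Δ` is a level-`2` vector of type
`((0^{m−2},2,2))³` not vanishing at `⟨m⟩`, so `2 ∈ passLevels m 2`. [this node] -/
theorem two_mem_passLevels_two {m : ℕ} (hm : 2 ≤ m) : 2 ∈ passLevels m 2 := by
  obtain ⟨d, rfl⟩ : ∃ d, m = d + 2 := ⟨m - 2, by omega⟩
  obtain ⟨Δ, hΔ1, hΔ⟩ := exists_level_two_vector_unit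
  have hlift : liftPoly d Δ ∈ hwvSpace (rectType (d + 2) 2 2) (2 * 2) := by
    rw [← liftType_rectType le_rfl]
    exact liftPoly_mem_hwvSpace hΔ
  intro hle
  have h0 := hle hlift 1 1 1 (by simp) (by simp) (by simp)
  rw [actTensor_one, evalT_liftPoly, cornerOf_unitTensor, hΔ1] at h0
  exact one_ne_zero h0

/-- An empty level does not pass. [bookkeeping] -/
theorem not_mem_passLevels_of_mem_emptyLevels {m N k : ℕ} (hk : k ∈ emptyLevels m N) : k ∉ passLevels m N := by
  intro h
  apply h
  have hbot : hwvSpace (rectType m N k) (k * N) = ⊥ := hk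
  rw [hbot]
  exact bot_le

/-- **The passing levels of format 2:** for `m ≥ 2`, `k ∈ passLevels m 2 ↔ k` is even. [this node] -/
theorem mem_passLevels_two_iff {m k : ℕ} (hm : 2 ≤ m) : k ∈ passLevels m 2 ↔ Even k := by
  constructor
  · intro h
    rcases Nat.even_or_odd k with he | ho
    · exact he
    · exact absurd h (not_mem_passLevels_of_mem_emptyLevels ((mem_emptyLevels_two_iff hm).mpr ho))
  · rintro ⟨j, rfl⟩
    rw [← two_mul, mul_comm]
    exact mul_mem_passLevels (two_mem_passLevels_two hm) j

/-- **The first column of the tower is decided:** for `m ≥ 2` every level of block format `2` either passes (even) or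
is empty (odd) — no level of format `2` is non-empty yet vanishing on the unit orbit. [this node] -/
theorem mem_passLevels_two_or_mem_emptyLevels_two {m : ℕ} (hm : 2 ≤ m) (k : ℕ) :
    k ∈ passLevels m 2 ∨ k ∈ emptyLevels m 2 := by
  rcases Nat.even_or_odd k with he | ho
  · exact Or.inl ((mem_passLevels_two_iff hm).mpr he)
  · exact Or.inr ((mem_emptyLevels_two_iff hm).mpr ho)

/-- Level `2` is a level of the unit tensor `⟨m⟩` at block format `2`, `m ≥ 2`. [this node] -/
theorem two_mem_pointLevels_unitTensor {m : ℕ} (hm : 2 ≤ m) : 2 ∈ pointLevels 2 (unitTensor ℂ m) := by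
  obtain ⟨d, rfl⟩ : ∃ d, m = d + 2 := ⟨m - 2, by omega⟩
  obtain ⟨Δ, hΔ1, hΔ⟩ := exists_level_two_vector_unit
  refine ⟨liftPoly d Δ, ?_, ?_⟩
  · rw [← liftType_rectType le_rfl]
    exact liftPoly_mem_hwvSpace hΔ
  · rw [evalT_liftPoly, cornerOf_unitTensor, hΔ1]
    exact one_ne_zero

end FormatTwoPassLevels

end Summit.MatrixMultiplication.MatrixMultiplication.Theorems.ObstructionCalculus

end
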